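import Summits.QuantumFields.YangMills.Theses.RenyiTelescope
import Summits.QuantumFields.YangMills.Theorems.RenyiTelescopeConditionalTelescope
import Summits.QuantumFields.YangMills.Theorems.RenyiTelescopePlaquetteTransport
import Summits.QuantumFields.YangMills.Theorems.RenyiTelescopeUnitEventReduction
import Summits.QuantumFields.YangMills.Theorems.RenyiTelescopeAbstractBootstrap
import Summits.QuantumFields.YangMills.Theorems.RenyiTelescopeInteriorComplement
import Summits.QuantumFields.YangMills.Theorems.RenyiTelescopeTelescopedCrux
import Summits.QuantumFields.YangMills.Theorems.RenyiTelescopeArithClosure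
import Summits.QuantumFields.YangMills.Theorems.RenyiTelescopeGlueRest

/-!
# Route `RenyiTelescope` — THE GLUE ITEM `HistoryTailOfRenyiTelescope` (stmt-QuantumFields-27139, support r9), PROVED
# (ideator seat `ym-r3-idea-2` g3; the sorry-free composition of the registered skeleton v7)

`HistoryTailOfRenyiTelescope : CutoffRenyiL → FineRegimeUnitTailL → UnitScaleTilt.HistoryTailL` — the two CRUXES of LINE «RenyiTelescope»
imply the history-tail crux `HistoryTailL` of route `UnitScaleTilt` (stmt-QuantumFields-19936).  Composition of the landed stubs:
conditional telescope (p622611) · plaquette-event transport (p623159) · unit-event reduction (p623509) · abstract bootstrap (p623811) ·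
interior complement (p623983) · telescoped crux (p624262) · arithmetic closure (p625032) · instantiation (p624729).

WHAT THIS IS NOT: the cruxes `CutoffRenyiL` (stmt-QuantumFields-27137) and `FineRegimeUnitTailL` (stmt-QuantumFields-27138) are OPEN; this is an
implication between route items, not a Gibbs-measure estimate; `HistoryTailL`, the rung R3 (`YM3TorusSU2`) and the mass gap are NOT proved.

References: T. Bałaban, CMP 102 (1985) 255–275 [Balaban1985UV3] ((7) p.257, (60) p.270, (71) p.273); C. King, CMP 103 (1986) 323–349 [King1986]
(Thm 3.4 p.334).
-/

namespace Summit.QuantumFields.YangMills.Theorems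

/-- **THE GLUE OF LINE «RenyiTelescope»**: `CutoffRenyiL → FineRegimeUnitTailL → HistoryTailL`. [cite: Balaban1985UV3, (7) p.257 and (71) p.273;
King1986, Thm 3.4 p.334] -/
theorem historyTailOfRenyiTelescope : Summit.QuantumFields.YangMills.Theses.RenyiTelescope.HistoryTailOfRenyiTelescope :=
  fun hC hF => RenyiTelescope.stub_unitEventReduction RenyiTelescope.stub_plaquetteTransport
    (RenyiTelescope.stub_glueRest (RenyiTelescope.stub_telescopedCrux hC RenyiTelescope.stub_conditionalTelescope) hF
      RenyiTelescope.stub_abstractBootstrap RenyiTelescope.stub_interiorComplement RenyiTelescope.stub_arithClosure)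

end Summit.QuantumFields.YangMills.Theorems
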